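import Literature.MathematicalPhysics.QuantumFieldTheory.Balaban1983to89.B9Eq3102QprimeCommutatorLetters
import Literature.MathematicalPhysics.QuantumFieldTheory.Balaban1983to89.B9Eq387IMSLocalLettersLattice

/-!
# `Balaban1983to89.B9Eq3102QprimeCommutatorLettersCarrier` — T. Bałaban, *Propagators for lattice gauge theories in a background field*, Commun.
# Math. Phys. **99** (1985) 389–434 [Balaban1985BackgroundPropagators] (3.102) p. 414 with (3.19) p. 393, (3.24) p. 394, (3.11) p. 392 and p. 408
# «Σ_□ h²_□ = 1»: **THE SCALAR `Q̃′` COMMUTATOR LETTERS ON THE CHAIN's WEIGHTED CARRIERS AND THE (dn) ROW OF THE IMS IDENTITIES FOR `Q̃′`**: for ANY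
# maps `T`, `χ_S^j`, `χ_G^j` HYPOTHESISED to act as the one-step gauge-parameter averaging `Q′(U)` (3.19) from the fine `c₀`-carrier to the coarse
# `c₁`-carrier and as pointwise real multipliers, with contour transports `≤ M_A` and the block-oscillation letter `Θ`: `‖Tλ‖ ≤ M_A‖λ‖`,
# `Σ_j‖χ_G^j(Tλ) − T(χ_S^jλ)‖² ≤ M_A²Θ‖λ‖²`, `‖Tλ‖·‖Σ_j ad_j(ad_jT)λ‖ ≤ M_A²Θ‖λ‖²` at the diagonal `c₁ = L^d·c₀`, hence
# `Σ_j‖T(χ_S^jλ)‖² ≤ ‖Tλ‖² + 2M_A²Θ‖λ‖²` — the `Q′`-ANALOGUE of kernel 7's `T₃` row, i.e. the (dn) row an IMS localisation of the gauge-parameter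
# operator `Δ′_{a′}(U) = Δ^η_U + a′Q′*Q′` (3.24) would consume for its averaging member (kernel 7's OWN `T₃` is the VECTOR averaging `√a·Q(U)` (3.15) on
# 1-forms — ne9-leaf-01 g82's `B9Eq387IMSAveragingLettersLattice`, W-1 journal l.50082) — route R2′ STEP B8′ of the pub-balaban NE9 chain

statement-level skeleton of published theorems with citation tags; proofs where landed; nothing here is a claim about the Yang–Mills mass gap

CITATION HEADER (lean-in-tree rule).  Audit cell `pub-balaban`, sub-cell `t4`, BINDER row NE9; filed by NE9 formalisation-swarm leaf prover 05
(`b2b-balaban-t4-ne9-formalise-leaf-05`, gen 74) as the SEQUEL of `B9Eq3102QprimeCommutatorLetters` (this lineage, same generation: the identities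
(3.102) and the `ℓ²` sizes at FUNCTION level), joined BY NAME with ne9-leaf-01 g81's `B9Eq387IMSLocalLettersLattice` §2 `sum_norm_sq_apply_localised_le`
(p352029; the (dn) shape for ONE local letter from the two commutator sizes).  LOCATED READING of record (ne9-leaf-01 g82 W-1 l.50082, concurred): the
local letters of kernel 7 `B9Eq387IMSAssembly` live on 1-forms ((3.26) p. 395: `T₁ = D_U`, `T₂ = D_U†`, `T₃ = √a·Q(U)` = `B9Eq315QTorus.QtorusW`); the
scalar `Q′ = B9Eq319QprimeTorus.QprimeLin` ∕ `QprimeW` here is the averaging of `Δ′_a` (3.24), rows L8∕L9 of the instance ledger through `G′ = (Δ′_a)⁻¹`;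
so this file is the `Q′`-ANALOGUE of the `T₃` letters, for a localisation of `Δ′_{a′}(U)` should the route book one (t4-ne9-idea-1 to rule) — NOT a row of
kernel 7's bond-form assembly.  Source READ in the held text (`paper:balaban1985-cmp99-background-propagators`): p. 414 (3.102) *«(Q_j hA)(c) =
h(c₋)(Q_jA)(c) + (S_j(∂h)A)(c)»*, l.1–3 *«of the order O(M⁻¹), or O(M⁻²), if considered on a proper scale»*; p. 408 *«We have Σ_{□∈𝒟} h²_□ = 1»*;
(3.24) p. 394 *«Δ′_a(U) = Δ^η_U + Q′*(U)aQ′(U)»*; (3.19) p. 393; (3.11) p. 392.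

WHY.  The chain's one-step gauge-parameter averaging on the `L²` carriers is `Q̃′(U) = (WL2.linearEquiv ℂ ℂ c₁)⁻¹ ∘ B9Eq326OperatorAssembly.QprimeW L m φ U`
(`B9Eq3101ConjugationLettersChain.QprimeW_eq_QprimeLin`: `rfl` on the underlying function); cut-offs are realised as CLMs acting pointwise
(`B9Eq387IMSLocalLettersLattice.exists_pointwise_clm_family`).  This file states the three commutator sizes for ANY maps with those two ACTION hypotheses
(`hT`, `hS`∕`hG` — `rfl`-dischargeable at the chain; nothing defined, FREEZE (0)), in the shapes the IMS identities consume (kernel 7's `t`, `a`, `k`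
alphabet and ne9-leaf-01's product shape).  The coarse multiplier may be sampled anywhere (`χ′_j`); for the (dn) row ONE partition `Σ_j χ_j² = 1` on the
fine torus is sampled at the block centre `centre L m y` on the coarse torus, and the block-oscillation letter reads `Σ_j (χ_j(L·y) − χ_j(x))² ≤ Θ` on `x ∈ B(y)`.

WHAT IS PROVED (sorry-free; proof lane — no `def`; [folklore] bookkeeping over the parent; nothing of [B9] asserted).
* §1 (general weights `c₀`, `c₁`; factor `K = c₁(c₀L^d)⁻¹`): **`norm_T_le`** (L-t: `‖Tλ‖ ≤ M_A√K‖λ‖`), **`sum_norm_sq_comm_T_le`** (L-a: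
  `Σ_j‖χ_G^j(Tλ) − T(χ_S^jλ)‖² ≤ M_A²ΘK‖λ‖²` — ne9-leaf-01's `hAD` shape), `norm_sum_comm_comm_T_le` (`‖Σ_j (χ_G^j(ad_jTλ) − ad_jT(χ_S^jλ))‖ ≤ M_AΘ√K‖λ‖`),
  **`norm_mul_norm_sum_comm_comm_T_le`** (L-k: `‖Tλ‖·‖Σ_j …‖ ≤ M_A²ΘK‖λ‖²` — the `hTK` shape).
* §2 AT THE DIAGONAL `c₁ = L^d·c₀` (route R2′'s point `ηL = 1`): **`norm_T_le_diagonal`** (size `M_A`), **`sum_norm_sq_comm_T_le_diagonal`** (square `M_A²Θ`),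
  **`norm_sum_comm_comm_T_le_diagonal`** (double commutator `M_AΘ` — kernel 7's `hT`∕`hAD`∕`hK` shapes take the letters separately),
  **`norm_mul_norm_sum_comm_comm_T_le_diagonal`** (product `M_A²Θ` — ne9-leaf-01's shape) — no `η`, no `L`, no volume, no count of the family.
* §3 THE (dn) ROW FOR THE SCALAR `Q̃′` (CLMs, ONE partition `Σ_jχ_j(x)² = 1` on the fine torus sampled at the block centres on the coarse torus):
  **`sum_norm_sq_T_localised_le`** (`Σ_j‖T(χ_S^jλ)‖² ≤ ‖Tλ‖² + 2M_A²ΘK·‖λ‖²`) and **`sum_norm_sq_T_localised_le_diagonal`** (`… + 2M_A²Θ‖λ‖²`) —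
  `B9Eq387IMSLocalLettersLattice.sum_norm_sq_apply_localised_le` BY NAME at `π_S = id`, `π_E = centre L m`.
HONEST SCOPE.  Letters and one (dn) row for the scalar `Q̃′`; NOT kernel 7's `T₃` (vector `Q(U)`, ne9-leaf-01 g82); `M_A` and `Θ` DISPLAYED — the
block-oscillation letter from a BOND letter along the block contours (`Θ ≤ (d(L−1))²Θ₂`), the tree's `C^{1,1}` partition `B5SmoothPartition.hS` and
`M_A = M_φM_φ′` at the chain's `adTransportW φ U` (`U(b) ∈ U1`, this lineage's `B9Eq319ContourAxialGauge.hA_letter_AdW`) are the SEQUEL's; the weight `√a′`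
multiplies square and product by `a′` (words); ONE operator's letters, NOT NE9 (cell pub-balaban: NE9 NOT PRINTED ∕ NOT PROVED; «NE9 ⇐ the named
binders»; spine PROVED 0∕9; rung (B)+1 on a finite T⁴ — NOT infinite volume, NOT mass gap, NOT Clay; HONEST DEPENDENCY: continuum YM on T⁴ ⇐ BetaPertH ∧
nine spine estimates (0/9 proved); BetaPertH ⇐ (D1) ∧ (D4) ∧ CAP+tail; G-an2-4 gates asym, D1 and NE2/3/4).  NEW file importing the parent and ne9-leaf-01's
`B9Eq387IMSLocalLettersLattice`; nothing modified.  Net new unproved facts: 0.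
-/

noncomputable section

open scoped InnerProductSpace
open Finset

namespace Literature.MathematicalPhysics.QuantumFieldTheory.Balaban1983to89.B9Eq3102QprimeCommutatorLettersCarrier

open B4Sect5Torus (TSite)
open B9SectCLatticeCarrier (Bond)
open B9Eq311L2Pairing (WL2)
open B11Eq103H1Complex (SiteL2K)
open B9Eq323Ker (pathTr)
open B9Eq319QprimeTorus (fineP centre contour stepTransport QprimeLin)
open B9Eq3102QprimeCommutatorLetters (sum_norm_sq_QprimeLin_le sum_sum_norm_sq_comm_QprimeLin_le sum_norm_sq_sum_comm_comm_QprimeLin_le)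

section Arithmetic

/-- the weights' bookkeeping: `c₁·(L^{−d}·S) = (c₁(c₀L^d)⁻¹)·(c₀·S)` (private arithmetic helper). [folklore] -/
private theorem weight_identity {d : ℕ} (L : ℕ) [NeZero L] {c₀ : ℝ} [Fact (0 < c₀)] (c₁ S : ℝ) :
    c₁ * (((L : ℝ) ^ d)⁻¹ * S) = c₁ * (c₀ * (L : ℝ) ^ d)⁻¹ * (c₀ * S) := by
  have hc₀ : 0 < c₀ := Fact.out
  have hL : (0 : ℝ) < (L : ℝ) ^ d := by
    have : (0 : ℝ) < L := by exact_mod_cast Nat.pos_of_ne_zero (NeZero.ne L)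
    positivity
  field_simp

/-- at `c₁ = L^d·c₀` the weight factor is `1` (private arithmetic helper). [folklore] -/
private theorem weight_factor_eq_one {d : ℕ} (L : ℕ) [NeZero L] {c₀ c₁ : ℝ} [Fact (0 < c₀)] (hc : c₁ = (L : ℝ) ^ d * c₀) :
    c₁ * (c₀ * (L : ℝ) ^ d)⁻¹ = 1 := by
  have hc₀ : 0 < c₀ := Fact.out
  have hL : (0 : ℝ) < (L : ℝ) ^ d := by
    have : (0 : ℝ) < L := by exact_mod_cast Nat.pos_of_ne_zero (NeZero.ne L)
    positivity
  rw [hc]; field_simp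

/-- from `a² ≤ b²·K` with `b, K ≥ 0` conclude `a ≤ b·√K` for `a ≥ 0` (private helper). [folklore] -/
private theorem le_mul_sqrt_of_sq_le {a b K : ℝ} (ha : 0 ≤ a) (hb : 0 ≤ b) (hK : 0 ≤ K) (h : a ^ 2 ≤ b ^ 2 * K) : a ≤ b * Real.sqrt K := by
  have h' : a ^ 2 ≤ (b * Real.sqrt K) ^ 2 := by rwa [mul_pow, Real.sq_sqrt hK]
  exact (pow_le_pow_iff_left₀ ha (mul_nonneg hb (Real.sqrt_nonneg _)) two_ne_zero).1 h'

end Arithmetic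

/-! ## §1 The three letters on the weighted carriers, general weights -/

section Carrier

variable {d : ℕ} (L : ℕ) [NeZero L] (m : Fin d → ℕ) {W : Type*} [NormedAddCommGroup W] [InnerProductSpace ℂ W] {c₀ c₁ : ℝ}
  [Fact (0 < c₀)] [Fact (0 < c₁)] {Rb : Bond d (fineP L m) → W →ₗ[ℂ] W} {MA : ℝ}
  (hA : ∀ (y : TSite d m), ∀ x ∈ B9Eq319QprimeTorus.blockOf L m y, ∀ v : W,
    ‖pathTr (stepTransport L m fun b => (Rb b).restrictScalars ℝ) (centre L m y :: contour L m x) v‖ ≤ MA * ‖v‖)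
  (T : SiteL2K ℂ d (fineP L m) c₀ W → WL2 ℂ (fun _ : TSite d m => c₁) W)
  (hT : ∀ (f : SiteL2K ℂ d (fineP L m) c₀ W) (y : TSite d m),
    WL2.equiv ℂ (fun _ : TSite d m => c₁) W (T f) y = QprimeLin L m Rb (WL2.equiv ℂ (fun _ : TSite d (fineP L m) => c₀) W f) y)

include hA hT in
/-- **(L-t) THE SIZE LETTER FOR THE SCALAR `Q̃′` ON THE WEIGHTED CARRIERS** (kernel 7's `t`): for ANY map `T` acting as `Q′` from the fine `c₀`-carrier to the coarse `c₁`-carrier (e.g. the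
chain's `(WL2.linearEquiv … c₁)⁻¹ ∘ QprimeW L m φ U`, by `rfl`) with contour transports bounded by `M_A ≥ 0`: `‖Tλ‖ ≤ M_A·√(c₁(c₀L^d)⁻¹)·‖λ‖`.
[cite: Balaban1985BackgroundPropagators, (3.19) p.393, (3.11) p.392] -/
theorem norm_T_le (hMA : 0 ≤ MA) (f : SiteL2K ℂ d (fineP L m) c₀ W) : ‖T f‖ ≤ MA * Real.sqrt (c₁ * (c₀ * (L : ℝ) ^ d)⁻¹) * ‖f‖ := by
  have hc₀ : 0 < c₀ := Fact.out
  have hc₁ : 0 < c₁ := Fact.out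
  have hL : (0 : ℝ) < (L : ℝ) ^ d := by
    have : (0 : ℝ) < L := by exact_mod_cast Nat.pos_of_ne_zero (NeZero.ne L)
    positivity
  set l : TSite d (fineP L m) → W := WL2.equiv ℂ (fun _ : TSite d (fineP L m) => c₀) W f with hl
  have hsq : ‖T f‖ ^ 2 ≤ (MA * ‖f‖) ^ 2 * (c₁ * (c₀ * (L : ℝ) ^ d)⁻¹) := by
    rw [WL2.norm_sq, mul_pow, WL2.norm_sq f]
    simp only [hT]
    rw [← mul_sum, ← mul_sum]
    calc c₁ * ∑ y, ‖QprimeLin L m Rb l y‖ ^ 2 ≤ c₁ * (MA ^ 2 * (((L : ℝ) ^ d)⁻¹ * ∑ x, ‖l x‖ ^ 2)) :=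
          mul_le_mul_of_nonneg_left (sum_norm_sq_QprimeLin_le L m hA l) hc₁.le
      _ = MA ^ 2 * (c₀ * ∑ x, ‖l x‖ ^ 2) * (c₁ * (c₀ * (L : ℝ) ^ d)⁻¹) := by
          rw [mul_left_comm, weight_identity L (c₀ := c₀)]; ring
  calc ‖T f‖ ≤ MA * ‖f‖ * Real.sqrt (c₁ * (c₀ * (L : ℝ) ^ d)⁻¹) :=
        le_mul_sqrt_of_sq_le (norm_nonneg _) (mul_nonneg hMA (norm_nonneg _)) (by positivity) hsq
    _ = MA * Real.sqrt (c₁ * (c₀ * (L : ℝ) ^ d)⁻¹) * ‖f‖ := by ring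

variable {J : Type*} (s : Finset J) {χ' : J → TSite d m → ℝ} {χ : J → TSite d (fineP L m) → ℝ} {Θ : ℝ}
  (hΘ : ∀ (y : TSite d m), ∀ x ∈ B9Eq319QprimeTorus.blockOf L m y, ∑ j ∈ s, (χ' j y - χ j x) ^ 2 ≤ Θ)
  (χS : J → SiteL2K ℂ d (fineP L m) c₀ W → SiteL2K ℂ d (fineP L m) c₀ W)
  (χG : J → WL2 ℂ (fun _ : TSite d m => c₁) W → WL2 ℂ (fun _ : TSite d m => c₁) W)
  (hS : ∀ j (f : SiteL2K ℂ d (fineP L m) c₀ W) (x : TSite d (fineP L m)),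
    WL2.equiv ℂ (fun _ : TSite d (fineP L m) => c₀) W (χS j f) x = (χ j x : ℂ) • WL2.equiv ℂ (fun _ : TSite d (fineP L m) => c₀) W f x)
  (hG : ∀ j (g : WL2 ℂ (fun _ : TSite d m => c₁) W) (y : TSite d m),
    WL2.equiv ℂ (fun _ : TSite d m => c₁) W (χG j g) y = (χ' j y : ℂ) • WL2.equiv ℂ (fun _ : TSite d m => c₁) W g y)

omit [NeZero L] [Fact (0 < c₀)] [Fact (0 < c₁)] in
include hS in
/-- a multiplier acting pointwise IS that multiplication on the underlying function (private helper). [folklore] -/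
private theorem equiv_chiS (j : J) (f : SiteL2K ℂ d (fineP L m) c₀ W) :
    WL2.equiv ℂ (fun _ : TSite d (fineP L m) => c₀) W (χS j f) = fun x => (χ j x : ℂ) • WL2.equiv ℂ (fun _ : TSite d (fineP L m) => c₀) W f x :=
  funext fun x => hS j f x

omit [Fact (0 < c₀)] [Fact (0 < c₁)] in
include hT hS hG in
/-- the underlying function of the single commutator (private helper). [folklore] -/
private theorem equiv_comm (j : J) (f : SiteL2K ℂ d (fineP L m) c₀ W) (y : TSite d m) :
    WL2.equiv ℂ (fun _ : TSite d m => c₁) W (χG j (T f) - T (χS j f)) y =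
      (χ' j y : ℂ) • QprimeLin L m Rb (WL2.equiv ℂ (fun _ : TSite d (fineP L m) => c₀) W f) y -
        QprimeLin L m Rb (fun x => (χ j x : ℂ) • WL2.equiv ℂ (fun _ : TSite d (fineP L m) => c₀) W f x) y := by
  rw [B9Eq311L2Pairing.WL2.equiv_sub, Pi.sub_apply, hG, hT, hT, equiv_chiS L m χS hS]

omit [Fact (0 < c₀)] [Fact (0 < c₁)] in
include hT hS hG in
/-- the underlying function of the family's double-commutator sum (private helper). [folklore] -/
private theorem equiv_sum_comm_comm (f : SiteL2K ℂ d (fineP L m) c₀ W) (y : TSite d m) :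
    WL2.equiv ℂ (fun _ : TSite d m => c₁) W
        (∑ j ∈ s, ((χG j (χG j (T f) - T (χS j f))) - (χG j (T (χS j f)) - T (χS j (χS j f))))) y =
      ∑ j ∈ s, ((χ' j y : ℂ) • ((χ' j y : ℂ) • QprimeLin L m Rb (WL2.equiv ℂ (fun _ : TSite d (fineP L m) => c₀) W f) y -
          QprimeLin L m Rb (fun x => (χ j x : ℂ) • WL2.equiv ℂ (fun _ : TSite d (fineP L m) => c₀) W f x) y) -
        ((χ' j y : ℂ) • QprimeLin L m Rb (fun x => (χ j x : ℂ) • WL2.equiv ℂ (fun _ : TSite d (fineP L m) => c₀) W f x) y -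
          QprimeLin L m Rb (fun x => (χ j x : ℂ) • ((χ j x : ℂ) • WL2.equiv ℂ (fun _ : TSite d (fineP L m) => c₀) W f x)) y)) := by
  have e := congrFun (map_sum (WL2.linearEquiv ℂ ℂ (fun _ : TSite d m => c₁) (V := W))
    (fun j => (χG j (χG j (T f) - T (χS j f))) - (χG j (T (χS j f)) - T (χS j (χS j f)))) s) y
  simp only [B9Eq311L2Pairing.WL2.linearEquiv_apply, Finset.sum_apply] at e
  rw [e]
  refine sum_congr rfl fun j _ => ?_
  rw [B9Eq311L2Pairing.WL2.equiv_sub, Pi.sub_apply, hG, equiv_comm L m T hT χS χG hS hG,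
    B9Eq311L2Pairing.WL2.equiv_sub, Pi.sub_apply, hG, hT, hT]
  simp only [equiv_chiS L m χS hS]

include hA hT hΘ hS hG in
/-- **(L-a) THE FIRST-ORDER SQUARE FOR THE SCALAR `Q̃′` ON THE WEIGHTED CARRIERS**: multipliers `χ_S^j` (fine, by `χ_j(x)`) and `χ_G^j` (coarse, by `χ′_j(y)`), block
oscillation `Σ_{j∈s}(χ′_j(y) − χ_j(x))² ≤ Θ` on `x ∈ B(y)`, transports `≤ M_A`: `Σ_j ‖χ_G^j(Tλ) − T(χ_S^jλ)‖² ≤ M_A²Θ·c₁(c₀L^d)⁻¹·‖λ‖²` — ne9-leaf-01's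
`hAD` shape (kernel 7's `a`), for the scalar `Q̃′`. [folklore] [cite: Balaban1985BackgroundPropagators, (3.102) p.414, p.408, (3.11) p.392] -/
theorem sum_norm_sq_comm_T_le (f : SiteL2K ℂ d (fineP L m) c₀ W) :
    ∑ j ∈ s, ‖χG j (T f) - T (χS j f)‖ ^ 2 ≤ MA ^ 2 * Θ * (c₁ * (c₀ * (L : ℝ) ^ d)⁻¹) * ‖f‖ ^ 2 := by
  have hc₁ : 0 < c₁ := Fact.out
  set l : TSite d (fineP L m) → W := WL2.equiv ℂ (fun _ : TSite d (fineP L m) => c₀) W f with hl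
  have e : ∀ j ∈ s, ‖χG j (T f) - T (χS j f)‖ ^ 2 = c₁ * ∑ y, ‖(χ' j y : ℂ) • QprimeLin L m Rb l y -
      QprimeLin L m Rb (fun x => (χ j x : ℂ) • l x) y‖ ^ 2 := by
    intro j _
    rw [WL2.norm_sq]
    simp only [equiv_comm L m T hT χS χG hS hG]
    rw [← mul_sum]
  rw [sum_congr rfl e, ← mul_sum, WL2.norm_sq f, ← mul_sum]
  calc c₁ * ∑ j ∈ s, ∑ y, ‖(χ' j y : ℂ) • QprimeLin L m Rb l y - QprimeLin L m Rb (fun x => (χ j x : ℂ) • l x) y‖ ^ 2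
      ≤ c₁ * (MA ^ 2 * Θ * (((L : ℝ) ^ d)⁻¹ * ∑ x, ‖l x‖ ^ 2)) :=
        mul_le_mul_of_nonneg_left (sum_sum_norm_sq_comm_QprimeLin_le L m hA s hΘ l) hc₁.le
    _ = MA ^ 2 * Θ * (c₁ * (c₀ * (L : ℝ) ^ d)⁻¹) * (c₀ * ∑ x, ‖l x‖ ^ 2) := by
        rw [mul_left_comm, weight_identity L (c₀ := c₀)]; ring

include hA hT hΘ hS hG in
/-- **THE DOUBLE-COMMUTATOR SUM ON THE WEIGHTED CARRIERS**: with `Θ ≥ 0`,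
`‖Σ_j (χ_G^j(χ_G^j(Tλ) − T(χ_S^jλ)) − (χ_G^j(T(χ_S^jλ)) − T(χ_S^j(χ_S^jλ))))‖ ≤ M_AΘ·√(c₁(c₀L^d)⁻¹)·‖λ‖`. [folklore]
[cite: Balaban1985BackgroundPropagators, (3.102) p.414 «O(M⁻²)», (3.11) p.392] -/
theorem norm_sum_comm_comm_T_le (hMA : 0 ≤ MA) (hΘ0 : 0 ≤ Θ) (f : SiteL2K ℂ d (fineP L m) c₀ W) :
    ‖∑ j ∈ s, ((χG j (χG j (T f) - T (χS j f))) - (χG j (T (χS j f)) - T (χS j (χS j f))))‖ ≤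
      MA * Θ * Real.sqrt (c₁ * (c₀ * (L : ℝ) ^ d)⁻¹) * ‖f‖ := by
  have hc₀ : 0 < c₀ := Fact.out
  have hc₁ : 0 < c₁ := Fact.out
  have hL : (0 : ℝ) < (L : ℝ) ^ d := by
    have : (0 : ℝ) < L := by exact_mod_cast Nat.pos_of_ne_zero (NeZero.ne L)
    positivity
  set l : TSite d (fineP L m) → W := WL2.equiv ℂ (fun _ : TSite d (fineP L m) => c₀) W f with hl
  have hsq : ‖∑ j ∈ s, ((χG j (χG j (T f) - T (χS j f))) - (χG j (T (χS j f)) - T (χS j (χS j f))))‖ ^ 2 ≤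
      (MA * Θ * ‖f‖) ^ 2 * (c₁ * (c₀ * (L : ℝ) ^ d)⁻¹) := by
    rw [WL2.norm_sq, mul_pow, WL2.norm_sq f]
    simp only [equiv_sum_comm_comm L m T hT s χS χG hS hG]
    rw [← mul_sum, ← mul_sum]
    calc _ ≤ c₁ * ((MA * Θ) ^ 2 * (((L : ℝ) ^ d)⁻¹ * ∑ x, ‖l x‖ ^ 2)) :=
          mul_le_mul_of_nonneg_left (sum_norm_sq_sum_comm_comm_QprimeLin_le L m hA s hΘ l) hc₁.le
      _ = (MA * Θ) ^ 2 * (c₀ * ∑ x, ‖l x‖ ^ 2) * (c₁ * (c₀ * (L : ℝ) ^ d)⁻¹) := by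
          rw [mul_left_comm, weight_identity L (c₀ := c₀)]; ring
  calc _ ≤ MA * Θ * ‖f‖ * Real.sqrt (c₁ * (c₀ * (L : ℝ) ^ d)⁻¹) :=
        le_mul_sqrt_of_sq_le (norm_nonneg _) (by positivity) (by positivity) hsq
    _ = MA * Θ * Real.sqrt (c₁ * (c₀ * (L : ℝ) ^ d)⁻¹) * ‖f‖ := by ring

include hA hT hΘ hS hG in
/-- **(L-k) THE PRODUCT LETTER FOR THE SCALAR `Q̃′` ON THE WEIGHTED CARRIERS** (the cross term of an IMS assembly in kernel 7's shape: the family's double commutator against `Tλ` itself):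
`‖Tλ‖·‖Σ_j (χ_G^j(χ_G^j(Tλ) − T(χ_S^jλ)) − (χ_G^j(T(χ_S^jλ)) − T(χ_S^j(χ_S^jλ))))‖ ≤ M_A²Θ·c₁(c₀L^d)⁻¹·‖λ‖²` — ne9-leaf-01's `hTK` shape.
[folklore] [cite: Balaban1985BackgroundPropagators, (3.102) p.414, (3.19) p.393, (3.11) p.392] -/
theorem norm_mul_norm_sum_comm_comm_T_le (hMA : 0 ≤ MA) (hΘ0 : 0 ≤ Θ) (f : SiteL2K ℂ d (fineP L m) c₀ W) :
    ‖T f‖ * ‖∑ j ∈ s, ((χG j (χG j (T f) - T (χS j f))) - (χG j (T (χS j f)) - T (χS j (χS j f))))‖ ≤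
      MA ^ 2 * Θ * (c₁ * (c₀ * (L : ℝ) ^ d)⁻¹) * ‖f‖ ^ 2 := by
  have hK : 0 ≤ c₁ * (c₀ * (L : ℝ) ^ d)⁻¹ := by
    have hc₀ : 0 < c₀ := Fact.out
    have hc₁ : 0 < c₁ := Fact.out
    positivity
  have ht := norm_T_le L m hA T hT hMA f
  have hk := norm_sum_comm_comm_T_le L m hA T hT s hΘ χS χG hS hG hMA hΘ0 f
  have ht0 : 0 ≤ MA * Real.sqrt (c₁ * (c₀ * (L : ℝ) ^ d)⁻¹) * ‖f‖ := by positivity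
  calc _ ≤ (MA * Real.sqrt (c₁ * (c₀ * (L : ℝ) ^ d)⁻¹) * ‖f‖) * (MA * Θ * Real.sqrt (c₁ * (c₀ * (L : ℝ) ^ d)⁻¹) * ‖f‖) :=
        mul_le_mul ht hk (norm_nonneg _) ht0
    _ = MA ^ 2 * Θ * (Real.sqrt (c₁ * (c₀ * (L : ℝ) ^ d)⁻¹) ^ 2) * ‖f‖ ^ 2 := by ring
    _ = MA ^ 2 * Θ * (c₁ * (c₀ * (L : ℝ) ^ d)⁻¹) * ‖f‖ ^ 2 := by rw [Real.sq_sqrt hK]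

/-! ## §2 At the diagonal `c₁ = L^d·c₀` (route R2′'s point `ηL = 1`): size `M_A`, square and product `M_A²Θ`, double commutator `M_AΘ` -/

include hA hT in
/-- **(L-t) AT THE DIAGONAL — size `M_A`**: `‖Tλ‖ ≤ M_A‖λ‖` — no `η`, no `L`, no volume. [cite: Balaban1985BackgroundPropagators, (3.19) p.393, (3.11) p.392] -/
theorem norm_T_le_diagonal (hMA : 0 ≤ MA) (hc : c₁ = (L : ℝ) ^ d * c₀) (f : SiteL2K ℂ d (fineP L m) c₀ W) : ‖T f‖ ≤ MA * ‖f‖ := by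
  have h := norm_T_le L m hA T hT hMA f
  rwa [weight_factor_eq_one L hc, Real.sqrt_one, mul_one] at h

include hA hT hΘ hS hG in
/-- **(L-a) AT THE DIAGONAL — square `M_A²Θ`**: `Σ_j ‖χ_G^j(Tλ) − T(χ_S^jλ)‖² ≤ M_A²Θ·‖λ‖²` — no `η`, no `L`, no volume, no family count.
[folklore] [cite: Balaban1985BackgroundPropagators, (3.102) p.414, p.408, (3.11) p.392] -/
theorem sum_norm_sq_comm_T_le_diagonal (hc : c₁ = (L : ℝ) ^ d * c₀) (f : SiteL2K ℂ d (fineP L m) c₀ W) :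
    ∑ j ∈ s, ‖χG j (T f) - T (χS j f)‖ ^ 2 ≤ MA ^ 2 * Θ * ‖f‖ ^ 2 := by
  have h := sum_norm_sq_comm_T_le L m hA T hT s hΘ χS χG hS hG f
  rwa [weight_factor_eq_one L hc, mul_one] at h

include hA hT hΘ hS hG in
/-- **THE DOUBLE-COMMUTATOR LETTER `M_AΘ` AT THE DIAGONAL** (the shape `hK` of an IMS assembly in kernel 7's form, which takes `t`, `k`, `a` separately):
`‖Σ_j (χ_G^j(ad_jTλ) − ad_jT(χ_S^jλ))‖ ≤ M_AΘ·‖λ‖`. [folklore] [cite: Balaban1985BackgroundPropagators, (3.102) p.414 «O(M⁻²)», (3.11) p.392] -/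
theorem norm_sum_comm_comm_T_le_diagonal (hMA : 0 ≤ MA) (hΘ0 : 0 ≤ Θ) (hc : c₁ = (L : ℝ) ^ d * c₀) (f : SiteL2K ℂ d (fineP L m) c₀ W) :
    ‖∑ j ∈ s, ((χG j (χG j (T f) - T (χS j f))) - (χG j (T (χS j f)) - T (χS j (χS j f))))‖ ≤ MA * Θ * ‖f‖ := by
  have h := norm_sum_comm_comm_T_le L m hA T hT s hΘ χS χG hS hG hMA hΘ0 f
  rwa [weight_factor_eq_one L hc, Real.sqrt_one, mul_one] at h

include hA hT hΘ hS hG in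
/-- **(L-k) AT THE DIAGONAL — product `M_A²Θ`**: `‖Tλ‖·‖Σ_j (χ_G^j(ad_jTλ) − ad_jT(χ_S^jλ))‖ ≤ M_A²Θ·‖λ‖²`. [folklore]
[cite: Balaban1985BackgroundPropagators, (3.102) p.414, (3.19) p.393, (3.11) p.392] -/
theorem norm_mul_norm_sum_comm_comm_T_le_diagonal (hMA : 0 ≤ MA) (hΘ0 : 0 ≤ Θ) (hc : c₁ = (L : ℝ) ^ d * c₀)
    (f : SiteL2K ℂ d (fineP L m) c₀ W) :
    ‖T f‖ * ‖∑ j ∈ s, ((χG j (χG j (T f) - T (χS j f))) - (χG j (T (χS j f)) - T (χS j (χS j f))))‖ ≤ MA ^ 2 * Θ * ‖f‖ ^ 2 := by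
  have h := norm_mul_norm_sum_comm_comm_T_le L m hA T hT s hΘ χS χG hS hG hMA hΘ0 f
  rwa [weight_factor_eq_one L hc, mul_one] at h

end Carrier

/-! ## §3 The (dn) row of the IMS identities for the scalar `Q̃′` — ne9-leaf-01's §2 BY NAME -/

section DnRow

open B9Eq387IMSLocalLettersLattice (sum_norm_sq_apply_localised_le)

variable {d : ℕ} (L : ℕ) [NeZero L] (m : Fin d → ℕ) {W : Type*} [NormedAddCommGroup W] [InnerProductSpace ℂ W] {c₀ c₁ : ℝ}
  [Fact (0 < c₀)] [Fact (0 < c₁)] {Rb : Bond d (fineP L m) → W →ₗ[ℂ] W} {MA : ℝ}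
  (hA : ∀ (y : TSite d m), ∀ x ∈ B9Eq319QprimeTorus.blockOf L m y, ∀ v : W,
    ‖pathTr (stepTransport L m fun b => (Rb b).restrictScalars ℝ) (centre L m y :: contour L m x) v‖ ≤ MA * ‖v‖)
  (T : SiteL2K ℂ d (fineP L m) c₀ W →L[ℂ] WL2 ℂ (fun _ : TSite d m => c₁) W)
  (hT : ∀ (f : SiteL2K ℂ d (fineP L m) c₀ W) (y : TSite d m),
    WL2.equiv ℂ (fun _ : TSite d m => c₁) W (T f) y = QprimeLin L m Rb (WL2.equiv ℂ (fun _ : TSite d (fineP L m) => c₀) W f) y)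
  {J : Type*} (s : Finset J) {χ : J → TSite d (fineP L m) → ℝ} {Θ : ℝ} (hχ1 : ∀ x, ∑ j ∈ s, χ j x ^ 2 = 1)
  (hΘ : ∀ (y : TSite d m), ∀ x ∈ B9Eq319QprimeTorus.blockOf L m y, ∑ j ∈ s, (χ j (centre L m y) - χ j x) ^ 2 ≤ Θ)
  (χS : J → SiteL2K ℂ d (fineP L m) c₀ W →L[ℂ] SiteL2K ℂ d (fineP L m) c₀ W)
  (χG : J → WL2 ℂ (fun _ : TSite d m => c₁) W →L[ℂ] WL2 ℂ (fun _ : TSite d m => c₁) W)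
  (hS : ∀ j (f : SiteL2K ℂ d (fineP L m) c₀ W) (x : TSite d (fineP L m)),
    WL2.equiv ℂ (fun _ : TSite d (fineP L m) => c₀) W (χS j f) x = (χ j x : ℂ) • WL2.equiv ℂ (fun _ : TSite d (fineP L m) => c₀) W f x)
  (hG : ∀ j (g : WL2 ℂ (fun _ : TSite d m => c₁) W) (y : TSite d m),
    WL2.equiv ℂ (fun _ : TSite d m => c₁) W (χG j g) y = (χ j (centre L m y) : ℂ) • WL2.equiv ℂ (fun _ : TSite d m => c₁) W g y)

include hA hT hχ1 hΘ hS hG in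
/-- **THE (dn) ROW FOR THE SCALAR `Q̃′`**: CLMs `χ_S^j` (fine sites, by `χ_j(x)`) and `χ_G^j` (coarse sites, by `χ_j(L·y)` — the block centre) from ONE
quadratic partition `Σ_j χ_j(x)² = 1` with block oscillation `Σ_{j∈s} (χ_j(L·y) − χ_j(x))² ≤ Θ` on `x ∈ B(y)` (`0 ≤ Θ`), a CLM `T` acting as `Q′`
with contour transports `≤ M_A` (`0 ≤ M_A`): `Σ_j ‖T(χ_S^jλ)‖² ≤ ‖Tλ‖² + 2·M_A²Θ·c₁(c₀L^d)⁻¹·‖λ‖²` — ne9-leaf-01's `sum_norm_sq_apply_localised_le`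
at `π_S = id`, `π_E = centre L m` with §1's (L-a) and (L-k). [folklore] (IMS localisation)
[cite: Balaban1985BackgroundPropagators, (3.102) p.414, p.408, (3.87)–(3.89) p.409, (3.19) p.393] -/
theorem sum_norm_sq_T_localised_le (hMA : 0 ≤ MA) (hΘ0 : 0 ≤ Θ) (f : SiteL2K ℂ d (fineP L m) c₀ W) :
    ∑ j ∈ s, ‖T (χS j f)‖ ^ 2 ≤ ‖T f‖ ^ 2 + 2 * (MA ^ 2 * Θ * (c₁ * (c₀ * (L : ℝ) ^ d)⁻¹)) * ‖f‖ ^ 2 := by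
  have h := sum_norm_sq_apply_localised_le s id (centre L m) χ χS χG hS hG hχ1 T
    (fun x => sum_norm_sq_comm_T_le L m hA T hT s hΘ (fun j => χS j) (fun j => χG j) hS hG x)
    (fun x => norm_mul_norm_sum_comm_comm_T_le L m hA T hT s hΘ (fun j => χS j) (fun j => χG j) hS hG hMA hΘ0 x) f
  linarith

include hA hT hχ1 hΘ hS hG in
/-- **THE (dn) ROW FOR THE SCALAR `Q̃′` AT THE DIAGONAL `c₁ = L^d·c₀`**: `Σ_j ‖T(χ_S^jλ)‖² ≤ ‖Tλ‖² + 2M_A²Θ·‖λ‖²` — the per-letter (dn) step an IMS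
localisation of `Δ′_{a′}(U)` (3.24) would consume for its averaging member (constant `2M_A²Θ`): no `η`, no `L`, no volume, no count of the family.
[folklore] (IMS localisation) [cite: Balaban1985BackgroundPropagators, (3.102) p.414, p.408, (3.87)–(3.89) p.409, (3.19) p.393, (3.11) p.392] -/
theorem sum_norm_sq_T_localised_le_diagonal (hMA : 0 ≤ MA) (hΘ0 : 0 ≤ Θ) (hc : c₁ = (L : ℝ) ^ d * c₀)
    (f : SiteL2K ℂ d (fineP L m) c₀ W) :
    ∑ j ∈ s, ‖T (χS j f)‖ ^ 2 ≤ ‖T f‖ ^ 2 + 2 * (MA ^ 2 * Θ) * ‖f‖ ^ 2 := by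
  have h := sum_norm_sq_T_localised_le L m hA T hT s hχ1 hΘ χS χG hS hG hMA hΘ0 f
  rwa [weight_factor_eq_one L hc, mul_one] at h

end DnRow

end Literature.MathematicalPhysics.QuantumFieldTheory.Balaban1983to89.B9Eq3102QprimeCommutatorLettersCarrier

end
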